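import Summits.Ventures.CertifiedManyBodySolver.Downfold.OneBandInPlaneExpr
import Summits.Ventures.CertifiedManyBodySolver.Downfold.QuadrantCellCounting
import Summits.Ventures.CertifiedManyBodySolver.Downfold.EmeryFermiFillingGrid384
import HarnessLib

/-!
# The direct one-band in-plane band, III: the filling ↦ Fermi-energy map by row-threshold certificates (`K = 384 / 192`),
# and the van Hove filling

Venture CertifiedManyBodySolver, cell `pub/hubbard-downfold` (stage S1, technique B), seat hubbard-downfold-mod-4;
namespace `Summit.Ventures.CertifiedManyBodySolver.Downfold.Emery`. Everything PROVED; no number lives here. WHAT THIS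
IS NOT: a statement about any material (the shell amplitudes a consumer plugs in are SCREENING-GRADE Wannier outputs);
`U = 0` one-body kinematics; the Brillouin-zone fraction is Lebesgue measure, no k-mesh.

* §1 `ipOcc S ε`, `ipFilling S ε` — the occupied part of the quadrant `[0, π]²` (`ε(k) ≤ ε`) and its per-spin
  Brillouin-zone fraction (`quadFrac`); monotone in `ε`. One-band electron density `n = 2·ipFilling(ε_F)`; hole doping
  `x = 1 − 2·ipFilling(ε_F)`.
* §2 `IpAnti S` — the polynomial form `ε(u, v)` is DECREASING in each of `u = cos kx`, `v = cos ky` on `[−1, 1]²`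
  (the band increases along `kx` and along `ky` on the quadrant); obtained from the sign of `∂_u ε` (`ipAnti_of_deriv_nonpos`),
  which the tree's kd-tree verifier certifies from the shell list (`ipAnti_of_kdCheck`).
* §3 ROW-THRESHOLD certificates on a certified `K`-grid (`gridEncl384` of `EmeryFermiFillingGrid384`, or its every-other-node
  sub-grid `gridEncl192`): under
  `IpAnti`, one exact rational corner evaluation `ipBandQT` (= `ipBandQ`, Chebyshev tables computed once) per row certifies a whole row of cells inside / outside the
  occupied set (`ipRowInnerCheckG` / `ipRowOuterCheckG` on any certified grid, soundness via `QuadrantCellCounting`), hence two-sided filling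
  bounds (`rowSum_le_ipFilling`, `ipFilling_le_rowSum`), the value bracket at one energy (`ipFilling_mem_of_countCheck`)
  and the Fermi-energy bracket of a filling window (`fermi_mem_Icc_of_ipBracketCheck`).
* §4 the saddle point X = (π, 0): under `IpAnti` it is the maximum of the band on the axis `ky = 0` and the minimum on
  the zone face `kx = π` (`ipBand_axis_le_X`, `ipBand_X_le_face`); its energy is the rational `ipBandQ S (−1) 1`
  (`ipBandK_X`), so the VAN HOVE FILLING `ipFilling S ε(X)` — and the van Hove hole doping `1 − 2·ipFilling` — is
  bracketed by `ipFilling_mem_of_countCheck` at that exact energy (`vanHoveFilling_mem_of_countCheck`).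

Sources: `t–t′–t″` form and its saddle point [AndersenEtAl1995, §6]; interval/subdivision verification
[Moore1966, Theorem 3.1, §4.4].
-/

noncomputable section

namespace Summit.Ventures.CertifiedManyBodySolver.Downfold.Emery

open Real MeasureTheory Set Literature.Analysis.ValidatedNumerics

/-! ## §1 Occupied set and filling -/

/-- The occupied part of the quadrant at Fermi energy `ε`: `{k ∈ [0, π]² : ε(k) ≤ ε}`. [folklore] -/
def ipOcc (S : List (ℕ × ℕ × ℚ)) (ε : ℝ) : Set (ℝ × ℝ) :=
  {k | k ∈ quadrant ∧ ipBandK S k.1 k.2 ≤ ε}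

/-- THE FILLING (per spin) of the one-band band at Fermi energy `ε`: the Brillouin-zone fraction occupied
(`= n/2`; hole doping from half filling `x = 1 − 2·ipFilling`). [folklore] -/
def ipFilling (S : List (ℕ × ℕ × ℚ)) (ε : ℝ) : ℝ := quadFrac (ipOcc S ε)

/-- [folklore] -/
theorem ipOcc_subset (S : List (ℕ × ℕ × ℚ)) (ε : ℝ) : ipOcc S ε ⊆ quadrant := fun _ hk => hk.1

/-- The filling is monotone in the Fermi energy. [folklore] -/
theorem ipFilling_monotone (S : List (ℕ × ℕ × ℚ)) : Monotone (ipFilling S) := by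
  intro ε₁ ε₂ h
  exact quadFrac_mono (fun k hk => ⟨hk.1, hk.2.trans h⟩) (ipOcc_subset S ε₂)

/-- [folklore] -/
theorem ipFilling_nonneg (S : List (ℕ × ℕ × ℚ)) (ε : ℝ) : 0 ≤ ipFilling S ε := quadFrac_nonneg _

/-- [folklore] -/
theorem ipFilling_le_one (S : List (ℕ × ℕ × ℚ)) (ε : ℝ) : ipFilling S ε ≤ 1 := quadFrac_le_one (ipOcc_subset S ε)

/-! ## §2 Monotonicity of the polynomial form on the square -/

/-- `ε(u, v)` is DECREASING in each argument on `[−1, 1]²`. [folklore] -/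
def IpAnti (S : List (ℕ × ℕ × ℚ)) : Prop :=
  ∀ ⦃u v u' v' : ℝ⦄, u ∈ Icc (-1 : ℝ) 1 → v ∈ Icc (-1 : ℝ) 1 → u' ∈ Icc (-1 : ℝ) 1 → v' ∈ Icc (-1 : ℝ) 1 →
    u ≤ u' → v ≤ v' → ipBandUV S u' v' ≤ ipBandUV S u v

/-- **From the derivative sign**: `∂_u ε ≤ 0` on the square ⇒ `IpAnti` (the `v`-direction by the symmetry
`ipBandUV_comm`). [folklore] -/
theorem ipAnti_of_deriv_nonpos {S : List (ℕ × ℕ × ℚ)}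
    (h : ∀ u v : ℝ, u ∈ Icc (-1 : ℝ) 1 → v ∈ Icc (-1 : ℝ) 1 → ipBandU S u v ≤ 0) : IpAnti S := by
  -- antitone in `u` at fixed `v ∈ [-1,1]`
  have key : ∀ v : ℝ, v ∈ Icc (-1 : ℝ) 1 → AntitoneOn (fun u => ipBandUV S u v) (Icc (-1 : ℝ) 1) := by
    intro v hv
    refine antitoneOn_of_deriv_nonpos (convex_Icc _ _) ?_ ?_ ?_
    · exact fun u _ => (hasDerivAt_ipBandUV S u v).continuousAt.continuousWithinAt
    · exact fun u _ => (hasDerivAt_ipBandUV S u v).differentiableAt.differentiableWithinAt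
    · intro u hu
      rw [interior_Icc] at hu
      rw [(hasDerivAt_ipBandUV S u v).deriv]
      exact h u v (Ioo_subset_Icc_self hu) hv
  intro u v u' v' hu hv hu' hv' huu hvv
  calc ipBandUV S u' v' ≤ ipBandUV S u v' := key v' hv' hu hu' huu
    _ = ipBandUV S v' u := ipBandUV_comm S u v'
    _ ≤ ipBandUV S v u := key u hu hv hv' hvv
    _ = ipBandUV S u v := ipBandUV_comm S v u

/-- The kd-tree certificate of `∂_u ε ≤ 0` on `[−1, 1]²` (tree verifier `BoxCover`). [cite: Moore1966, Theorem 3.1, §4.4] -/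
def ipMonoKdCheck (S : List (ℕ × ℕ × ℚ)) (t : KdCert ℕ) : Bool :=
  t.check (exprLeOn (ipBandUE S) 0) [(-1, 1), (-1, 1)]

/-- **`IpAnti` from a passing kd certificate.** [cite: Moore1966, Theorem 3.1, §4.4] -/
theorem ipAnti_of_kdCheck {S : List (ℕ × ℕ × ℚ)} {t : KdCert ℕ} (h : ipMonoKdCheck S t = true) : IpAnti S := by
  refine ipAnti_of_deriv_nonpos fun u v hu hv => ?_
  have hu' : u ∈ Icc (((-1 : ℚ) : ℚ) : ℝ) ((1 : ℚ) : ℝ) := by simpa using hu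
  have hv' : v ∈ Icc (((-1 : ℚ) : ℚ) : ℝ) ((1 : ℚ) : ℝ) := by simpa using hv
  have := eval_le_of_kdCheck₂ (e := ipBandUE S) (b := 0) h hu' hv'
  simpa using this

/-! ## §3 Row-threshold certificates on a certified grid -/

/-- Chebyshev values `T₀ … T₄` at a rational `u`, computed ONCE per corner (kernel-evaluation economy). [folklore] -/
def chebTab (u : ℚ) : List ℚ :=
  [1, u, 2 * (u * u) - 1, (4 * (u * u) - 3) * u, (8 * (u * u) - 8) * (u * u) + 1]

/-- Table lookup `T_m` (`0` for `m ≥ 5`). [folklore] -/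
def chebT (T : List ℚ) (m : ℕ) : ℚ := T.getD m 0

/-- [folklore] -/
theorem chebT_chebTab (u : ℚ) (m : ℕ) : chebT (chebTab u) m = chebQ m u := by
  unfold chebT chebTab
  match m with
  | 0 => simp [chebQ]
  | 1 => simp [chebQ]
  | 2 => simp [chebQ]; ring
  | 3 => simp [chebQ]; ring
  | 4 => simp [chebQ]; ring
  | k + 5 => simp [chebQ]

/-- Star value from the two Chebyshev tables. [folklore] -/
def starT (m n : ℕ) (Tu Tv : List ℚ) : ℚ :=
  if n = 0 then (if m = 0 then 1 else 2 * (chebT Tu m + chebT Tv m))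
  else if m = n then 4 * (chebT Tu m * chebT Tv m)
  else 4 * (chebT Tu m * chebT Tv n + chebT Tu n * chebT Tv m)

/-- FAST exact evaluation of the band polynomial at a rational corner (tables computed once). [folklore] -/
def ipBandQT (S : List (ℕ × ℕ × ℚ)) (u v : ℚ) : ℚ :=
  let Tu := chebTab u
  let Tv := chebTab v
  (S.map fun s => s.2.2 * starT s.1 s.2.1 Tu Tv).sum

/-- `ipBandQT = ipBandQ`. [folklore] -/
theorem ipBandQT_eq (S : List (ℕ × ℕ × ℚ)) (u v : ℚ) : ipBandQT S u v = ipBandQ S u v := by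
  unfold ipBandQT
  simp only
  induction S with
  | nil => simp [ipBandQ]
  | cons s S ih =>
    simp only [List.map_cons, List.sum_cons, ipBandQ] at ih ⊢
    rw [ih]
    congr 1
    unfold starT starQ
    simp only [chebT_chebTab]


/-- Lower `u`-corner of a grid column from the UPPER half-angle table: `max (1 − 2·xh i) (−1)`. [folklore] -/
def uLoOf (xh : ℕ → ℚ) (i : ℕ) : ℚ := max (1 - 2 * xh i) (-1)

/-- Upper `u`-corner of a grid column from the LOWER half-angle table: `1 − 2·xl i`. [folklore] -/
def uHiOf (xl : ℕ → ℚ) (i : ℕ) : ℚ := 1 - 2 * xl i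

/-- `cos k = 1 − 2 sin²(k/2)`. [folklore] -/
theorem cos_eq_one_sub_two_halfSq (k : ℝ) : cos k = 1 - 2 * halfSq k := by
  rw [halfSq_eq_cos]; ring

/-- ROW-THRESHOLD INNER CHECK at energy `e` on a `K`-grid with upper half-angle table `xh`: for every row `i < K` a
threshold `jin i ≤ K` with the band at the worst corner `(uLoOf xh (i+1), uLoOf xh (jin i))` at most `e` (vacuous if
`jin i = 0`). [folklore] -/
def ipRowInnerCheckG (K : ℕ) (xh : ℕ → ℚ) (S : List (ℕ × ℕ × ℚ)) (e : ℚ) (jin : ℕ → ℕ) : Bool :=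
  (List.range K).all fun i =>
    decide (jin i ≤ K) && (decide (jin i = 0) || decide (ipBandQT S (uLoOf xh (i + 1)) (uLoOf xh (jin i)) ≤ e))

/-- ROW-THRESHOLD OUTER CHECK at energy `e` on a `K`-grid with lower half-angle table `xl`: for every row `i < K` a
threshold `jout i ≤ K` with the band at the best corner `(uHiOf xl i, uHiOf xl (jout i))` already above `e`
(vacuous if `jout i = K`). [folklore] -/
def ipRowOuterCheckG (K : ℕ) (xl : ℕ → ℚ) (S : List (ℕ × ℕ × ℚ)) (e : ℚ) (jout : ℕ → ℕ) : Bool :=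
  (List.range K).all fun i =>
    decide (jout i ≤ K) && (decide (jout i = K) || decide (e < ipBandQT S (uHiOf xl i) (uHiOf xl (jout i))))

/-- Cells below the inner thresholds are occupied. [folklore] -/
theorem cellIco_subset_ipOcc_of_rowInner {K : ℕ} (hK : 0 < K) {xl xh : ℕ → ℚ} (hG : GridEncl K xl xh)
    {S : List (ℕ × ℕ × ℚ)} (hS : shellsOK S = true) (hA : IpAnti S)
    {e : ℚ} {jin : ℕ → ℕ} (h : ipRowInnerCheckG K xh S e jin = true) :
    ∀ ij ∈ rowCells K jin, cellIco K ij ⊆ ipOcc S e := by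
  simp only [ipRowInnerCheckG, List.all_eq_true, List.mem_range, Bool.and_eq_true, Bool.or_eq_true,
    decide_eq_true_eq] at h
  intro ij hij k hk
  rw [mem_rowCells] at hij
  obtain ⟨hi, hj⟩ := hij
  obtain ⟨hjK, htest⟩ := h ij.1 hi
  rcases htest with h0 | htest
  · omega
  obtain ⟨⟨h1lo, h1hi⟩, ⟨h2lo, h2hi⟩⟩ := hk
  have hi1 : ij.1 + 1 ≤ K := hi
  have hjj : ij.2 + 1 ≤ jin ij.1 := hj
  have hk1π : k.1 ≤ π := h1hi.le.trans (gridPt_le_pi hK hi1)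
  have hk2g : k.2 ≤ gridPt K (jin ij.1) := h2hi.le.trans (gridPt_mono K hjj)
  have hk2π : k.2 ≤ π := hk2g.trans (gridPt_le_pi hK hjK)
  have hk10 : 0 ≤ k.1 := (gridPt_nonneg K ij.1).trans h1lo
  have hk20 : 0 ≤ k.2 := (gridPt_nonneg K ij.2).trans h2lo
  refine ⟨⟨⟨hk10, hk1π⟩, ⟨hk20, hk2π⟩⟩, ?_⟩
  have hx : halfSq k.1 ≤ (xh (ij.1 + 1) : ℝ) :=
    (halfSq_mono hk10 h1hi.le (gridPt_le_pi hK hi1)).trans (hG _ hi1).2.2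
  have hy : halfSq k.2 ≤ (xh (jin ij.1) : ℝ) :=
    (halfSq_mono hk20 hk2g (gridPt_le_pi hK hjK)).trans (hG _ hjK).2.2
  have hc1 := cos_eq_one_sub_two_halfSq k.1
  have hc2 := cos_eq_one_sub_two_halfSq k.2
  have hu : ((uLoOf xh (ij.1 + 1) : ℚ) : ℝ) ≤ cos k.1 := by
    unfold uLoOf; push_cast
    exact max_le (by linarith) (neg_one_le_cos _)
  have hv : ((uLoOf xh (jin ij.1) : ℚ) : ℝ) ≤ cos k.2 := by
    unfold uLoOf; push_cast
    exact max_le (by linarith) (neg_one_le_cos _)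
  have hU : ((uLoOf xh (ij.1 + 1) : ℚ) : ℝ) ∈ Icc (-1 : ℝ) 1 :=
    ⟨by unfold uLoOf; push_cast; exact le_max_right _ _, hu.trans (cos_le_one _)⟩
  have hV : ((uLoOf xh (jin ij.1) : ℚ) : ℝ) ∈ Icc (-1 : ℝ) 1 :=
    ⟨by unfold uLoOf; push_cast; exact le_max_right _ _, hv.trans (cos_le_one _)⟩
  have hmono := hA hU hV ⟨neg_one_le_cos _, cos_le_one _⟩ ⟨neg_one_le_cos _, cos_le_one _⟩ hu hv
  rw [ipBandQT_eq] at htest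
  have htest' := (Rat.cast_le (K := ℝ)).2 htest
  rw [cast_ipBandQ] at htest'
  show ipBandK S k.1 k.2 ≤ e
  rw [ipBandK_eq_UV hS]
  exact hmono.trans htest'

/-- Cells at or beyond the outer thresholds miss the occupied set. [folklore] -/
theorem disjoint_ipOcc_of_rowOuter {K : ℕ} (hK : 0 < K) {xl xh : ℕ → ℚ} (hG : GridEncl K xl xh)
    {S : List (ℕ × ℕ × ℚ)} (hS : shellsOK S = true) (hA : IpAnti S)
    {e : ℚ} {jout : ℕ → ℕ} (h : ipRowOuterCheckG K xl S e jout = true) :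
    ∀ i j, i < K → j < K → (i, j) ∉ rowCells K jout → Disjoint (cellIcc K (i, j)) (ipOcc S e) := by
  simp only [ipRowOuterCheckG, List.all_eq_true, List.mem_range, Bool.and_eq_true, Bool.or_eq_true,
    decide_eq_true_eq] at h
  intro i j hi hj hnot
  rw [mem_rowCells, not_and] at hnot
  have hjj : jout i ≤ j := not_lt.1 (hnot hi)
  obtain ⟨hjK, htest⟩ := h i hi
  rcases htest with hK' | htest
  · omega
  rw [Set.disjoint_left]
  rintro k ⟨⟨h1lo, h1hi⟩, ⟨h2lo, h2hi⟩⟩ hocc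
  obtain ⟨-, hocc⟩ := hocc
  have hk1π : k.1 ≤ π := h1hi.trans (gridPt_le_pi hK hi)
  have hk2π : k.2 ≤ π := h2hi.trans (gridPt_le_pi hK hj)
  have hx : (xl i : ℝ) ≤ halfSq k.1 :=
    (hG i hi.le).2.1.trans (halfSq_mono (gridPt_nonneg K i) h1lo hk1π)
  have hy : (xl (jout i) : ℝ) ≤ halfSq k.2 :=
    (hG (jout i) hjK).2.1.trans (halfSq_mono (gridPt_nonneg K _) ((gridPt_mono K hjj).trans h2lo) hk2π)
  have hx0 := (hG i hi.le).1
  have hy0 := (hG (jout i) hjK).1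
  have hx1 : (xl i : ℝ) ≤ 1 := (hG i hi.le).2.1.trans (halfSq_le_one _)
  have hy1 : (xl (jout i) : ℝ) ≤ 1 := (hG _ hjK).2.1.trans (halfSq_le_one _)
  have hc1 := cos_eq_one_sub_two_halfSq k.1
  have hc2 := cos_eq_one_sub_two_halfSq k.2
  have hu : cos k.1 ≤ ((uHiOf xl i : ℚ) : ℝ) := by unfold uHiOf; push_cast; linarith
  have hv : cos k.2 ≤ ((uHiOf xl (jout i) : ℚ) : ℝ) := by unfold uHiOf; push_cast; linarith
  have hU : ((uHiOf xl i : ℚ) : ℝ) ∈ Icc (-1 : ℝ) 1 := by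
    unfold uHiOf; push_cast; constructor <;> linarith
  have hV : ((uHiOf xl (jout i) : ℚ) : ℝ) ∈ Icc (-1 : ℝ) 1 := by
    unfold uHiOf; push_cast; constructor <;> linarith
  have hmono := hA ⟨neg_one_le_cos _, cos_le_one _⟩ ⟨neg_one_le_cos _, cos_le_one _⟩ hU hV hu hv
  rw [ipBandQT_eq] at htest
  have htest' := (Rat.cast_lt (K := ℝ)).2 htest
  rw [cast_ipBandQ] at htest'
  rw [ipBandK_eq_UV hS] at hocc
  linarith

/-- **ROW-THRESHOLD INNER THEOREM**: `rowSum jin / K² ≤ ipFilling(e)`. [folklore] -/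
theorem rowSum_le_ipFilling {K : ℕ} (hK : 0 < K) {xl xh : ℕ → ℚ} (hG : GridEncl K xl xh)
    {S : List (ℕ × ℕ × ℚ)} (hS : shellsOK S = true) (hA : IpAnti S)
    {e : ℚ} {jin : ℕ → ℕ} (h : ipRowInnerCheckG K xh S e jin = true) :
    ((rowSum K jin : ℕ) : ℝ) / (K : ℝ) ^ 2 ≤ ipFilling S e := by
  have := card_div_sq_le_quadFrac hK (ipOcc_subset S e) (rowCells K jin)
    (cellIco_subset_ipOcc_of_rowInner hK hG hS hA h)
  rw [card_rowCells] at this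
  exact this

/-- **ROW-THRESHOLD OUTER THEOREM**: `ipFilling(e) ≤ rowSum jout / K²`. [folklore] -/
theorem ipFilling_le_rowSum {K : ℕ} (hK : 0 < K) {xl xh : ℕ → ℚ} (hG : GridEncl K xl xh)
    {S : List (ℕ × ℕ × ℚ)} (hS : shellsOK S = true) (hA : IpAnti S)
    {e : ℚ} {jout : ℕ → ℕ} (h : ipRowOuterCheckG K xl S e jout = true) :
    ipFilling S e ≤ ((rowSum K jout : ℕ) : ℝ) / (K : ℝ) ^ 2 := by
  have := quadFrac_le_card_div_sq hK (ipOcc_subset S e) (rowCells K jout)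
    (disjoint_ipOcc_of_rowOuter hK hG hS hA h)
  rw [card_rowCells] at this
  exact this

/-- COUNT CHECK at one energy on a `K`-grid `(xl, xh)`: an outer and an inner row certificate at the same `e`. [folklore] -/
def ipCountCheckG (K : ℕ) (xl xh : ℕ → ℚ) (S : List (ℕ × ℕ × ℚ)) (e : ℚ) (jout jin : List ℕ) : Bool :=
  ipRowOuterCheckG K xl S e (fun i => jout.getD i 0) && ipRowInnerCheckG K xh S e (fun i => jin.getD i 0)

/-- **The filling at a rational energy is enclosed by the two counts.** [folklore] -/
theorem ipFilling_mem_of_countCheck {K : ℕ} (hK : 0 < K) {xl xh : ℕ → ℚ} (hG : GridEncl K xl xh)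
    {S : List (ℕ × ℕ × ℚ)} (hS : shellsOK S = true) (hA : IpAnti S)
    {e : ℚ} {jout jin : List ℕ} (h : ipCountCheckG K xl xh S e jout jin = true) :
    ipFilling S e ∈ Icc (((rowSum K (fun i => jin.getD i 0) : ℕ) : ℝ) / (K : ℝ) ^ 2)
      (((rowSum K (fun i => jout.getD i 0) : ℕ) : ℝ) / (K : ℝ) ^ 2) := by
  simp only [ipCountCheckG, Bool.and_eq_true] at h
  exact ⟨rowSum_le_ipFilling hK hG hS hA h.2, ipFilling_le_rowSum hK hG hS hA h.1⟩

/-- BRACKET CHECK of a filling window `[ν₁, ν₂]` on a `K`-grid: outer count at `e₁` below `ν₁·K²`, inner count at `e₂`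
above `ν₂·K²`. [folklore] -/
def ipBracketCheckG (K : ℕ) (xl xh : ℕ → ℚ) (S : List (ℕ × ℕ × ℚ)) (e₁ e₂ ν₁ ν₂ : ℚ) (jout jin : List ℕ) : Bool :=
  decide (e₁ ≤ e₂) &&
  ipRowOuterCheckG K xl S e₁ (fun i => jout.getD i 0) &&
  decide (((rowSum K (fun i => jout.getD i 0) : ℕ) : ℚ) < ν₁ * (K : ℚ) ^ 2) &&
  ipRowInnerCheckG K xh S e₂ (fun i => jin.getD i 0) &&
  decide (ν₂ * (K : ℚ) ^ 2 < ((rowSum K (fun i => jin.getD i 0) : ℕ) : ℚ))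

/-- **THE FERMI-ENERGY BRACKET**: every `ε` whose filling lies in `[ν₁, ν₂]` lies in `[e₁, e₂]`. [folklore] -/
theorem fermi_mem_Icc_of_ipBracketCheck {K : ℕ} (hK : 0 < K) {xl xh : ℕ → ℚ} (hG : GridEncl K xl xh)
    {S : List (ℕ × ℕ × ℚ)} (hS : shellsOK S = true) (hA : IpAnti S)
    {e₁ e₂ ν₁ ν₂ : ℚ} {jout jin : List ℕ} (h : ipBracketCheckG K xl xh S e₁ e₂ ν₁ ν₂ jout jin = true)
    {ε : ℝ} (hν : ipFilling S ε ∈ Icc (ν₁ : ℝ) ν₂) : ε ∈ Icc (e₁ : ℝ) e₂ := by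
  simp only [ipBracketCheckG, Bool.and_eq_true, decide_eq_true_eq] at h
  obtain ⟨⟨⟨⟨-, hout⟩, hso⟩, hin⟩, hsi⟩ := h
  have hKr : (0 : ℝ) < K := by exact_mod_cast hK
  have h1 := ipFilling_le_rowSum hK hG hS hA hout
  have h2 := rowSum_le_ipFilling hK hG hS hA hin
  have hso' : ((rowSum K (fun i => jout.getD i 0) : ℕ) : ℝ) / (K : ℝ) ^ 2 < (ν₁ : ℝ) := by
    rw [div_lt_iff₀ (by positivity)]
    have := (Rat.cast_lt (K := ℝ)).2 hso
    push_cast at this ⊢; exact this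
  have hsi' : (ν₂ : ℝ) < ((rowSum K (fun i => jin.getD i 0) : ℕ) : ℝ) / (K : ℝ) ^ 2 := by
    rw [lt_div_iff₀ (by positivity)]
    have := (Rat.cast_lt (K := ℝ)).2 hsi
    push_cast at this ⊢; exact this
  exact mem_Icc_of_monotone_bracket (ipFilling_monotone S) h1 hso' h2 hsi' hν

/-- The `K = 192` sub-grid of the certified `K = 384` table: every other node. [folklore] -/
def xl192 (i : ℕ) : ℚ := xl384 (2 * i)

/-- [folklore] -/
def xh192 (i : ℕ) : ℚ := xh384 (2 * i)

/-- **The `K = 192` table encloses `sin²(k_i/2)`** (from `gridEncl384`, `k_i^{(192)} = k_{2i}^{(384)}`). [folklore] -/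
theorem gridEncl192 : GridEncl 192 xl192 xh192 := by
  intro i hi
  have h := gridEncl384 (2 * i) (by omega)
  have hpt : gridPt 192 i = gridPt 384 (2 * i) := by
    unfold gridPt; push_cast; ring
  unfold xl192 xh192
  rw [hpt]
  exact h

/-! ## §4 The saddle point X = (π, 0) and the van Hove filling -/

/-- The energy at X = (π, 0) is the rational `ipBandQ S (−1) 1`. [folklore] -/
theorem ipBandK_X {S : List (ℕ × ℕ × ℚ)} (hS : shellsOK S = true) :
    ipBandK S π 0 = ((ipBandQ S (-1) 1 : ℚ) : ℝ) := by
  rw [ipBandK_eq_UV hS, cos_pi, cos_zero, cast_ipBandQ]; norm_num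

/-- Under `IpAnti`, X is the MAXIMUM of the band on the axis `ky = 0`. [folklore] -/
theorem ipBand_axis_le_X {S : List (ℕ × ℕ × ℚ)} (hS : shellsOK S = true) (hA : IpAnti S) (kx : ℝ) :
    ipBandK S kx 0 ≤ ipBandK S π 0 := by
  rw [ipBandK_eq_UV hS, ipBandK_eq_UV hS, cos_pi, cos_zero]
  exact hA (by norm_num) (by norm_num) ⟨neg_one_le_cos _, cos_le_one _⟩ (by norm_num) (neg_one_le_cos _) le_rfl

/-- Under `IpAnti`, X is the MINIMUM of the band on the zone face `kx = π`. [folklore] -/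
theorem ipBand_X_le_face {S : List (ℕ × ℕ × ℚ)} (hS : shellsOK S = true) (hA : IpAnti S) (ky : ℝ) :
    ipBandK S π 0 ≤ ipBandK S π ky := by
  rw [ipBandK_eq_UV hS, ipBandK_eq_UV hS, cos_pi, cos_zero]
  exact hA (by norm_num) ⟨neg_one_le_cos _, cos_le_one _⟩ (by norm_num) (by norm_num) le_rfl (cos_le_one _)

/-- **THE VAN HOVE FILLING BRACKET**: the per-spin filling at the saddle-point energy `ε(X)` is enclosed by two counts
at the rational `ipBandQ S (−1) 1`; the van Hove hole doping is `x_VH = 1 − 2·ipFilling S ε(X)`. [folklore] -/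
theorem vanHoveFilling_mem_of_countCheck {K : ℕ} (hK : 0 < K) {xl xh : ℕ → ℚ} (hG : GridEncl K xl xh)
    {S : List (ℕ × ℕ × ℚ)} (hS : shellsOK S = true) (hA : IpAnti S)
    {jout jin : List ℕ} (h : ipCountCheckG K xl xh S (ipBandQ S (-1) 1) jout jin = true) :
    ipFilling S (ipBandK S π 0) ∈ Icc (((rowSum K (fun i => jin.getD i 0) : ℕ) : ℝ) / (K : ℝ) ^ 2)
      (((rowSum K (fun i => jout.getD i 0) : ℕ) : ℝ) / (K : ℝ) ^ 2) := by
  rw [ipBandK_X hS]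
  exact ipFilling_mem_of_countCheck hK hG hS hA h

end Summit.Ventures.CertifiedManyBodySolver.Downfold.Emery
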